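import Summits.Ventures.PercRepro.ProfilePointedCircuitClassesStarSharpD0Z1
import Summits.Ventures.PercRepro.ProfilePointedCircuitClassesStarSharpRegimes
import Summits.Ventures.PercRepro.ProfilePointedCircuitClassesStarSharpParXF
import Summits.Ventures.PercRepro.ProfilePointedCircuitClassesStarSharpPencilA
import Summits.Ventures.PercRepro.ProfilePointedCircuitClassesStarSharpPencilL

/-!
# PercRepro — CASE D0 OF `StarNineSharp`
(p5, gen 55–56; `proofs/P5-GM1.md` §82 ADD 9, §83)

`inCount_thru_le_of_D0`: under the standing hypotheses of case D0, the `b′`-avoiding inequality holds — the seven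
regime theorems: the loop regime (`ρ{b, b′} = 1`), `b ∥ e`, `b ∥ f`, `b ∥ y` for a point `y ∈ X`, `b` generic with no
ON line through `e`, `b` generic on the line `ef`, and `b` generic on a line through `e` and a point `ℓ ∈ X`
(the pencil through `ℓ`, part L).  The case split is by the rank of `{b, b′}` and of `{x, b, b′}` for `x ∈ E₇`, by
the second point of the ON line through `e`, and by whether the line `ef` is ON.
-/

open scoped Matroid

namespace PercRepro.Cogirth

open Finset ThmH Skew Shadow Profile

open Classical

variable {α : Type} [DecidableEq α] {N : Matroid α} [N.Finite]

section StarSharpD0Dispatch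

variable {b b' : α}

/-- `{e, ℓ} + f = {e, f, ℓ}`. -/
theorem insert_f_el_eq (e f l : α) : insert f ({e, l} : Finset α) = {e, f, l} := by
  ext z; simp only [mem_insert, mem_singleton]; tauto

/-- `{e, f} + b′ + b ⊆ {e, ℓ} + b′ + b + f`. -/
theorem insert_bb'_ef_subset_insert_f (b b' e f l : α) :
    insert b (insert b' ({e, f} : Finset α)) ⊆ insert f (insert b (insert b' {e, l})) := by
  intro z hz; simp only [mem_insert, mem_singleton] at hz ⊢; tauto

/-- `{e, b, b′} ⊆ {e, f} + b′ + b`. -/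
theorem ebb'_subset_insert_bb'_ef (b b' e f : α) :
    ({e, b, b'} : Finset α) ⊆ insert b (insert b' {e, f}) := by
  intro z hz; simp only [mem_insert, mem_singleton] at hz ⊢; tauto

/-- **CASE D0**: the seven regime theorems give the `b′`-avoiding inequality. -/
theorem inCount_thru_le_of_D0 (hn : (gr N).card = 9) (hR : rk N (gr N) = 5)
    (hcf : ∀ x ∈ gr N, rk N ((gr N).erase x) = 5) (h : SeriesPair N b b')
    {e f : α} (he : e ∈ gr N) (hf : f ∈ gr N) (hef : e ≠ f) (heb : e ≠ b) (heb' : e ≠ b') (hfb : f ≠ b) (hfb' : f ≠ b')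
    (hE7 : rk N (((gr N).erase b).erase b') = 4)
    (he1 : ∀ y ∈ ((((gr N).erase b).erase b').erase f).erase e, rk N {e, y} = 2)
    (hf1 : ∀ y ∈ ((((gr N).erase b).erase b').erase f).erase e, rk N {f, y} = 2)
    (hfc : ∀ y ∈ ((((gr N).erase b).erase b').erase f).erase e, rk N (((((gr N).erase b).erase b').erase f).erase y) = 4)
    (hX : rk N (((((gr N).erase b).erase b').erase f).erase e) = 4) (hef2 : rk N {e, f} = 2) :
    inCount N 4 e + thruCount N 4 {b', f} + thruCount N 4 {b', e, f} ≤
      inCount N 4 f + thruCount N 4 {e, f} + thruCount N 4 {b', e} := by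
  have hb : b ∈ gr N := h.1
  have hb' : b' ∈ gr N := h.2.1
  have hbb' : b ≠ b' := h.2.2.1
  have hXg : ((((gr N).erase b).erase b').erase f).erase e ⊆ gr N :=
    (erase_subset _ _).trans ((erase_subset _ _).trans ((erase_subset _ _).trans (erase_subset _ _)))
  have he1' : rk N ({e} : Finset α) = 1 := by
    have h1 := rk_insert_le_add_one (N := N) hf (X := ({e} : Finset α)) (singleton_subset_iff.2 he)
    have h2 := rk_le_card' (M := N) ({e} : Finset α)
    rw [card_singleton] at h2
    rw [pair_comm' f e, hef2] at h1
    omega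
  -- `ρ{b, b′} ∈ {1, 2}`
  have hbb_le : rk N {b, b'} ≤ 2 := by
    have := rk_le_card' (M := N) ({b, b'} : Finset α)
    rw [card_pair hbb'] at this
    exact this
  have hbb_ge : 1 ≤ rk N {b, b'} := by
    have h1 := rk_union_add_rk_le_of_subset_inter' (N := N) (S := ((gr N).erase b).erase b') (T := {b, b'}) (I := ∅)
      (empty_subset _)
    have h2 : rk N (gr N) ≤ rk N (((gr N).erase b).erase b' ∪ {b, b'}) := by
      apply rk_mono'
      intro u hu
      by_cases hub : u = b
      · rw [hub]; exact mem_union_right _ (mem_insert_self _ _)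
      by_cases hub' : u = b'
      · rw [hub']; exact mem_union_right _ (mem_insert_of_mem (mem_singleton_self _))
      · exact mem_union_left _ (mem_erase.2 ⟨hub', mem_erase.2 ⟨hub, hu⟩⟩)
    rw [hR] at h2
    rw [hE7] at h1
    omega
  by_cases hbb : rk N {b, b'} = 1
  · exact inCount_thru_le_of_loop hn h he hf hef heb heb' hfb hfb' he1 hf1 hfc hX hef2 hbb
  have hbb2 : rk N {b, b'} = 2 := by omega
  -- the rank of `{x, b, b′}` is `2` or `3`
  have hx_bnd : ∀ x ∈ gr N, 2 ≤ rk N {x, b, b'} ∧ rk N {x, b, b'} ≤ 3 := by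
    intro x hx
    have h1 : rk N {b, b'} ≤ rk N {x, b, b'} := rk_mono' (subset_insert _ _)
    have h2 := rk_insert_le_add_one (N := N) hx (X := {b, b'}) (insert_subset hb (singleton_subset_iff.2 hb'))
    rw [hbb2] at h1 h2
    exact ⟨h1, h2⟩
  by_cases hpe : rk N {e, b, b'} = 2
  · exact inCount_thru_le_of_par_e hn h he hf hef heb heb' hfb hfb' he1 hf1 hfc hX hef2 hpe hbb2
  by_cases hpf : rk N {f, b, b'} = 2
  · exact inCount_thru_le_of_par_f hn h he hf hef heb heb' hfb hfb' he1 hf1 hfc hX hef2 hpf hbb2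
  by_cases hpX : ∃ y ∈ ((((gr N).erase b).erase b').erase f).erase e, rk N {y, b, b'} = 2
  · obtain ⟨y, hyX, hpar⟩ := hpX
    exact inCount_thru_le_of_par_X hn h he hf hef heb heb' hfb hfb' he1 hf1 hfc hX hef2 hyX hpar hbb2
  push Not at hpX
  have hbg : ∀ y ∈ ((((gr N).erase b).erase b').erase f).erase e, rk N {y, b, b'} = 3 := by
    intro y hy
    have := hx_bnd y (hXg hy)
    have := hpX y hy
    omega
  by_cases hnle : ∀ S : Finset α, S ⊆ ((gr N).erase b).erase b' → e ∈ S → rk N (insert b (insert b' S)) ≤ 3 →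
      rk N S ≤ 1
  · exact inCount_thru_le_of_no_on_line_e hn hR hcf h he hf hef heb heb' hfb hfb' hE7 hnle he1 hf1 hfc hX hef2 hbg
  · have hpe3 : rk N {e, b, b'} = 3 := by have := hx_bnd e he; omega
    have hpf3 : rk N {f, b, b'} = 3 := by have := hx_bnd f hf; omega
    -- an ON line through `e`: a point `l ≠ e` of `E₇` with `ρ{e, l} = 2` and `ρ{e, l, b, b′} = 3`
    push Not at hnle
    obtain ⟨S, hS, heS, hSon, hS2⟩ := hnle
    have hSg : S ⊆ gr N := hS.trans ((erase_subset _ _).trans (erase_subset _ _))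
    have hl : ∃ l ∈ S, rk N {e, l} = 2 := by
      by_contra hno
      push Not at hno
      have h1 : rk N ({e} ∪ S) = rk N {e} := by
        apply rk_union_eq_of_forall_insert_eq (N := N) (Y := {e}) S
        intro l hl
        have h2 : rk N {e} ≤ rk N (insert l {e}) := rk_mono' (subset_insert _ _)
        have h3 : rk N (insert l {e}) ≤ 2 := by
          have := rk_le_card' (M := N) (insert l {e})
          have := card_insert_le l ({e} : Finset α)
          rw [card_singleton] at *
          omega
        have h4 := hno l hl
        rw [pair_comm'] at h4
        rw [he1'] at h2 ⊢
        omega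
      have h5 : rk N S ≤ rk N ({e} ∪ S) := rk_mono' subset_union_right
      have h6 := rk_le_card' (M := N) ({e} : Finset α)
      rw [card_singleton] at h6
      omega
    obtain ⟨l, hlS, hel⟩ := hl
    have hlon : rk N (insert b (insert b' {e, l})) = 3 := by
      have h1 : rk N (insert b (insert b' {e, l})) ≤ rk N (insert b (insert b' S)) :=
        rk_mono' (insert_subset_insert _ (insert_subset_insert _ (insert_subset heS (singleton_subset_iff.2 hlS))))
      have h3 : ({e, l} : Finset α) ⊆ ((gr N).erase b).erase b' := insert_subset (hS heS) (singleton_subset_iff.2 (hS hlS))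
      have h4 := rk_insert_bb'_bounds h h3
      rw [hel] at h4
      omega
    have hle : l ≠ e := by
      rintro rfl
      have := rk_le_card' (M := N) ({l} : Finset α)
      rw [card_singleton] at this
      rw [insert_eq_of_mem (mem_singleton_self _)] at hel
      omega
    by_cases hlf : l = f
    · rw [hlf] at hlon
      exact inCount_thru_le_of_pencil_f hn h he hf hef heb heb' hfb hfb' he1 hf1 hfc hX hef2 hlon hpe3
    · have hlX : l ∈ ((((gr N).erase b).erase b').erase f).erase e :=
        mem_erase.2 ⟨hle, mem_erase.2 ⟨hlf, hS hlS⟩⟩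
      by_cases hefon : rk N (insert b (insert b' {e, f})) = 3
      · exact inCount_thru_le_of_pencil_f hn h he hf hef heb heb' hfb hfb' he1 hf1 hfc hX hef2 hefon hpe3
      · -- `f` is off the ON line `eℓ`
        have hefl : rk N {e, f, l} = 3 := by
          by_contra hne
          have h1 : rk N {e, f} ≤ rk N {e, f, l} := rk_mono' (pair_ef_subset_eft e f l)
          have h2 := rk_le_card' (M := N) ({e, f, l} : Finset α)
          have h3 := card_insert_le e ({f, l} : Finset α)
          have h4 := card_le_two (a := f) (b := l)
          have hefl2 : rk N {e, f, l} = 2 := by rw [hef2] at h1; omega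
          have hfcl : rk N (insert f {e, l}) = rk N {e, l} := by rw [insert_f_el_eq, hefl2, he1 l hlX]
          have h5 := rk_insert_eq_of_rk_insert_eq_subset' (N := N) (S := {e, l}) (S' := insert b (insert b' {e, l}))
            ((subset_insert _ _).trans (subset_insert _ _)) hfcl
          have h6 : rk N (insert b (insert b' {e, f})) ≤ rk N (insert f (insert b (insert b' {e, l}))) :=
            rk_mono' (insert_bb'_ef_subset_insert_f b b' e f l)
          have h7 : rk N {e, b, b'} ≤ rk N (insert b (insert b' {e, f})) :=
            rk_mono' (ebb'_subset_insert_bb'_ef b b' e f)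
          rw [h5, hlon] at h6
          rw [hpe3] at h7
          exact hefon (by omega)
        exact inCount_thru_le_of_pencil_X hn hR h he hf hef heb heb' hfb hfb' he1 hf1 hfc hX hef2 hpe3 hbg hlX hlon
          hefl

end StarSharpD0Dispatch

end PercRepro.Cogirth
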